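import Summits.KontsevichZagierPeriods.Zeta5Search.Barrier.ConeGammaCuspSlopeCoboundary

/-!
# ζ(5) search — BARRIER: THE CUSP SLOPE IS LIPSCHITZ — `|σ(δ) − σ(δ′)| ≤ T·Σ_k |φ_k(δ − δ′)|`, hence continuous

HONEST FRAMING (cell `pub-zeta5`): systematic search; no irrationality claim unless kernel-certified. MODEL objects
under Brown–Zudilin's (28)+(30) accounting ([BZ22] = arXiv:2210.03391; (28) observed, not proved); nothing here is a
statement about `ζ(5)`, any `γ` of record, the cone's supremum (C2 OPEN) or the VALUE / SIGN of the cusp slope at a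
named direction (DATA of the cell); S-E stays CONJECTURED; records in print UNMOVED. Prover P2 g29, item
«CONTINUITY AND PIECEWISE LINEARITY» (INBOX 2026-08-27), file (1); companion of `ConeGammaCuspSlopeCoboundary`.

The translate integral `P(δ) = ∫₀ᵀ 𝒩(u·s(a) + δ) du` is Lipschitz in the displacement: P2 g20's exact equidistribution
(`setIntegral_abs_torusN_sub_le_period`, offset `δ′`, constant profile) bounds `|P(δ) − P(δ′)|` by
`T·Σ_k |φ_k(δ − δ′)|`. Lemma B at ONE scale admissible for both displacements (admissible scales are downward closed,
`admissible_of_le`) carries the bound to the cusp slope, with NO hypothesis on `δ, δ′`: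
* `translateIntegral_sub`, **`abs_translateIntegral_sub_le`** — `|P(δ) − P(δ′)| ≤ T·Σ_k |φ_k(δ − δ′)|`;
* **`abs_cuspSlope_sub_le`** — `|σ(δ) − σ(δ′)| ≤ T·Σ_k |φ_k(δ − δ′)|` for ALL `δ, δ′`; `abs_cuspSlope_le` (`δ′ = 0`);
  `abs_cuspSlope_sub_le_shiftSize` (`≤ 28·T·Y(δ − δ′)`);
* `abs_phiForm_le_two_mul_norm`, `sum_abs_phiForm_le`, **`lipschitzWith_cuspSlope`** (constant `56·T` in the sup norm
  of `ℝ⁸`), **`continuous_cuspSlope`** — the cusp slope is a continuous (indeed Lipschitz) degree-1 homogeneous function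
  of the displacement.
DESK (DATA, `HOME/pub-zeta5-p2/g29/alg/facelin.py`, exact): the ratio `|σ(δ) − σ(δ′)| / (T·Σ_k|φ_k(δ − δ′)|)` is at most
`0.158` on 45 sampled pairs at record/41, flag/60, argmax-120. NOT here (honest): any value at a named direction;
anything about `γ`, C2, S-E, `ζ(5)`.
-/

noncomputable section

open Set MeasureTheory
open scoped Topology

namespace Summit.KontsevichZagierPeriods.Zeta5Search.Barrier.ConeGamma

/-! ### The translate integral is Lipschitz -/

/-- `P(δ) − P(δ′)` as one interval integral. -/
theorem translateIntegral_sub (a : Dir) (T : ℝ) (δ δ' : Fin 8 → ℝ) :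
    translateIntegral a T δ - translateIntegral a T δ' =
      ∫ u in (0 : ℝ)..T, ((torusN (u • sParam a + δ) : ℝ) - torusN (u • sParam a + δ')) := by
  unfold translateIntegral
  rw [intervalIntegral.integral_sub (intervalIntegrable_torusN_line a δ 0 T)
    (intervalIntegrable_torusN_line a δ' 0 T)]

/-- **`P` IS LIPSCHITZ IN THE DISPLACEMENT.** For all 28 forms of `a` positive, `T ≥ 0` a period (`T·h_k(a) ∈ ℤ`) and
ANY two displacements: `|P(δ) − P(δ′)| ≤ T·Σ_k |φ_k(δ − δ′)|` (exact equidistribution over the period, form by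
form, `setIntegral_abs_torusN_sub_le_period` with offset `δ′` and the constant profile `1`). -/
theorem abs_translateIntegral_sub_le {a : Dir} (hpos : ∀ k, 0 < h28 a k) {T : ℝ} (hT : 0 ≤ T)
    (hper : ∀ k : Fin 28, ∃ z : ℤ, T * h28 a k = z) (δ δ' : Fin 8 → ℝ) :
    |translateIntegral a T δ - translateIntegral a T δ'| ≤ T * ∑ k, |phiForm (δ - δ') k| := by
  rw [translateIntegral_sub, intervalIntegral.integral_of_le hT]
  have h1 : |∫ u in Ioc 0 T, ((torusN (u • sParam a + δ) : ℝ) - torusN (u • sParam a + δ'))| ≤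
      ∫ u in Ioc 0 T, |(torusN (u • sParam a + δ) : ℝ) - torusN (u • sParam a + δ')| :=
    abs_integral_le_integral_abs
  have h2 := setIntegral_abs_torusN_sub_le_period hpos hT hper δ' (δ - δ') (fun _ => (1 : ℝ)) (t := 1)
    (fun _ _ => ⟨zero_le_one, le_rfl⟩)
  have h3 : ∀ u : ℝ, u • sParam a + δ' + (1 : ℝ) • (δ - δ') = u • sParam a + δ := fun u => by
    rw [one_smul]; abel
  simp_rw [h3, one_mul] at h2
  exact h1.trans h2

/-! ### The cusp slope is Lipschitz -/

/-- **THE CUSP SLOPE IS LIPSCHITZ.** For all 28 forms of `a` positive and a period `T > 0`: for ALL displacements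
`δ, δ′`, `|cuspSlope a T δ − cuspSlope a T δ′| ≤ T·Σ_k |φ_k(δ − δ′)|` — Lemma B (`cuspSlope_spec`) at ONE scale `ρ`
admissible for both (the minimum of two admissible scales, `admissible_of_le`) gives
`ρ·(σ(δ) − σ(δ′)) = P(ρδ) − P(ρδ′)`, and `abs_translateIntegral_sub_le` bounds the right-hand side by
`ρ·T·Σ_k |φ_k(δ − δ′)|`. -/
theorem abs_cuspSlope_sub_le {a : Dir} (hpos : ∀ k, 0 < h28 a k) {T : ℝ} (hT : 0 < T)
    (hper : ∀ k : Fin 28, ∃ z : ℤ, T * h28 a k = z) (δ δ' : Fin 8 → ℝ) :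
    |cuspSlope a T δ - cuspSlope a T δ'| ≤ T * ∑ k, |phiForm (δ - δ') k| := by
  obtain ⟨ρ₁, hρ₁, h11, h12, hg1⟩ := exists_admissible_scale hpos hT δ
  obtain ⟨ρ₂, hρ₂, h21, h22, hg2⟩ := exists_admissible_scale hpos hT δ'
  have hρ : 0 < min ρ₁ ρ₂ := lt_min hρ₁ hρ₂
  obtain ⟨a1, a2, ag⟩ := admissible_of_le hpos δ (min_le_left ρ₁ ρ₂) h11 h12 hg1
  obtain ⟨b1, b2, bg⟩ := admissible_of_le hpos δ' (min_le_right ρ₁ ρ₂) h21 h22 hg2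
  have e1 := cuspSlope_spec hpos hT hper δ hρ a1 a2 ag
  have e2 := cuspSlope_spec hpos hT hper δ' hρ b1 b2 bg
  have hP := abs_translateIntegral_sub_le hpos hT.le hper (min ρ₁ ρ₂ • δ) (min ρ₁ ρ₂ • δ')
  have hsub : translateIntegral a T (min ρ₁ ρ₂ • δ) - translateIntegral a T (min ρ₁ ρ₂ • δ') =
      min ρ₁ ρ₂ * (cuspSlope a T δ - cuspSlope a T δ') := by linear_combination e1 - e2
  have hforms : ∑ k, |phiForm (min ρ₁ ρ₂ • δ - min ρ₁ ρ₂ • δ') k| = min ρ₁ ρ₂ * ∑ k, |phiForm (δ - δ') k| := by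
    rw [← smul_sub, Finset.mul_sum]
    exact Finset.sum_congr rfl fun k _ => by rw [phiForm_smul, abs_mul, abs_of_pos hρ]
  rw [hsub, hforms, abs_mul, abs_of_pos hρ, mul_left_comm] at hP
  exact le_of_mul_le_mul_left hP hρ

/-- `|σ(δ)| ≤ T·Σ_k |φ_k(δ)|` (`δ′ = 0`, `cuspSlope_zero`). -/
theorem abs_cuspSlope_le {a : Dir} (hpos : ∀ k, 0 < h28 a k) {T : ℝ} (hT : 0 < T)
    (hper : ∀ k : Fin 28, ∃ z : ℤ, T * h28 a k = z) (δ : Fin 8 → ℝ) :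
    |cuspSlope a T δ| ≤ T * ∑ k, |phiForm δ k| := by
  have h := abs_cuspSlope_sub_le hpos hT hper δ 0
  rwa [cuspSlope_zero, sub_zero, sub_zero] at h

/-- In terms of the shift size `Y = max_k |φ_k|`: `|σ(δ) − σ(δ′)| ≤ 28·T·Y(δ − δ′)`. -/
theorem abs_cuspSlope_sub_le_shiftSize {a : Dir} (hpos : ∀ k, 0 < h28 a k) {T : ℝ} (hT : 0 < T)
    (hper : ∀ k : Fin 28, ∃ z : ℤ, T * h28 a k = z) (δ δ' : Fin 8 → ℝ) :
    |cuspSlope a T δ - cuspSlope a T δ'| ≤ 28 * T * shiftSize (δ - δ') := by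
  refine (abs_cuspSlope_sub_le hpos hT hper δ δ').trans ?_
  have h : ∑ k, |phiForm (δ - δ') k| ≤ ∑ _k : Fin 28, shiftSize (δ - δ') :=
    Finset.sum_le_sum fun k _ => abs_phiForm_le_shiftSize (δ - δ') k
  rw [Finset.sum_const, Finset.card_univ, Fintype.card_fin, nsmul_eq_mul] at h
  push_cast at h
  nlinarith [h, hT]

/-! ### Lipschitz in the sup norm, continuity -/

/-- Every form is a signed sum of two coordinates: `|φ_k(δ)| ≤ 2·‖δ‖` (sup norm on `ℝ⁸`). -/
theorem abs_phiForm_le_two_mul_norm (δ : Fin 8 → ℝ) (k : Fin 28) : |phiForm δ k| ≤ 2 * ‖δ‖ := by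
  have h : ∀ i, -‖δ‖ ≤ δ i ∧ δ i ≤ ‖δ‖ := fun i => by
    have := norm_le_pi_norm δ i
    rw [Real.norm_eq_abs] at this
    exact abs_le.mp this
  rw [phiForm_eq]
  unfold pairForm
  split_ifs
  · have := h 0; have := h (sndIdx k); rw [abs_le]; constructor <;> linarith
  · have := h 0; have := h (fstIdx k); rw [abs_le]; constructor <;> linarith
  · have := h (fstIdx k); have := h (sndIdx k); rw [abs_le]; constructor <;> linarith

/-- `Σ_k |φ_k(δ)| ≤ 56·‖δ‖`. -/
theorem sum_abs_phiForm_le (δ : Fin 8 → ℝ) : ∑ k, |phiForm δ k| ≤ 56 * ‖δ‖ := by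
  have h : ∑ k, |phiForm δ k| ≤ ∑ _k : Fin 28, 2 * ‖δ‖ :=
    Finset.sum_le_sum fun k _ => abs_phiForm_le_two_mul_norm δ k
  rw [Finset.sum_const, Finset.card_univ, Fintype.card_fin, nsmul_eq_mul] at h
  push_cast at h
  linarith

/-- **THE CUSP SLOPE IS `56·T`-LIPSCHITZ** on `ℝ⁸` with the sup norm (all 28 forms of `a` positive, `T > 0` a
period). -/
theorem lipschitzWith_cuspSlope {a : Dir} (hpos : ∀ k, 0 < h28 a k) {T : ℝ} (hT : 0 < T)
    (hper : ∀ k : Fin 28, ∃ z : ℤ, T * h28 a k = z) :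
    LipschitzWith (Real.toNNReal (56 * T)) (cuspSlope a T) := by
  refine LipschitzWith.of_dist_le' fun δ δ' => ?_
  rw [Real.dist_eq, dist_eq_norm]
  calc |cuspSlope a T δ - cuspSlope a T δ'| ≤ T * ∑ k, |phiForm (δ - δ') k| :=
        abs_cuspSlope_sub_le hpos hT hper δ δ'
    _ ≤ T * (56 * ‖δ - δ'‖) := mul_le_mul_of_nonneg_left (sum_abs_phiForm_le _) hT.le
    _ = 56 * T * ‖δ - δ'‖ := by ring

/-- **THE CUSP SLOPE IS CONTINUOUS** in the displacement. -/
theorem continuous_cuspSlope {a : Dir} (hpos : ∀ k, 0 < h28 a k) {T : ℝ} (hT : 0 < T)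
    (hper : ∀ k : Fin 28, ∃ z : ℤ, T * h28 a k = z) : Continuous (cuspSlope a T) :=
  (lipschitzWith_cuspSlope hpos hT hper).continuous

end Summit.KontsevichZagierPeriods.Zeta5Search.Barrier.ConeGamma

end
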